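import Summits.QuantumFields.YangMills.Theorems.PoincareLipschitzMedianCentringLinearTail
import Summits.QuantumFields.YangMills.Theorems.PoincareLipschitzHistoryTailOfVarianceBound
import HarnessLib

/-!
# Route `PoincareLipschitz` ∕ LINE 27 «MedianCentring» — helper T-8: «`HistoryTailL` MODULO {POINCARÉ K1 ROW, K2, QUANTILE}» — the Poincaré-row
# twin of ✓`historyTailL_of_expConcentration_quantile` (T-6), for the K2 display's second face

The K2 displays of record carry two K1 letters: the exponential-concentration row (K1-exp, `historyTailL_of_facts`) and the Poincaré ∕ variance-bound
row (`historyTailL_of_poincare_of_facts`, via ✓`PoincareLipschitzHistoryTailOfVarianceBound.historyTailL_of_varianceBound (hVar)(hLip)(hM) :=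
historyTailL_of_expConcentration (expConcentration_of_varianceBound hVar) hLip hM`).  This file is the (Q)-version of the latter, one line over T-6:
`historyTailL_of_varianceBound_quantile (hVar) (hLip) (hQ) := historyTailL_of_expConcentration_quantile (expConcentration_of_varianceBound hVar) hLip hQ`
— so a v8-class display can show the 3/4-quantile row (Q) in place of `MeanDeviationL` at EITHER K1 letter.  `hVar` is ✓`historyTailL_of_varianceBound`'s
binder verbatim; `hQ` is the registered text of LINE 27's stub `stub_quantileDeviation` (stmt-QuantumFields-23133) verbatim.

Width seat ym3-torus-px10 g6 (cell ym3-torus, WIDTH COPY «width 10»), `--supports stmt-QuantumFields-19936`.  A door: the Poincaré row, K2 `BlockLipschitzL` and (Q)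
are hypotheses, all OPEN; nothing of the cruxes or the rung (R3 = YM₃ on T³; NOT d = 4, NOT infinite volume, NOT a mass gap, NOT Clay) is proved; the Yang–Mills
mass gap is NOT proved.
-/

set_option autoImplicit false

noncomputable section

namespace Summit.QuantumFields.YangMills.Theorems.PoincareLipschitz.MedianCentring

open MeasureTheory
open scoped BigOperators
open Literature.MathematicalPhysics.QuantumFieldTheory.Balaban1983to89
open Literature.MathematicalPhysics.QuantumFieldTheory.Balaban1983to89.T3ContinuumYM3Torus
open Literature.MathematicalPhysics.QuantumFieldTheory.Balaban1983to89.T3UnitScaleTilt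
open Literature.MathematicalPhysics.QuantumFieldTheory.Balaban1983to89.T3UnitLawDensityEML (ℰp measurableE_ℰp)
open Summit.QuantumFields.YangMills.Theorems.PoincareLipschitzExpConcentrationOfVariance (expConcentration_of_varianceBound)

/-- ★★★ **`UnitScaleTilt.HistoryTailL ⟸ (Poincaré ∕ variance-bound K1 row) ∧ BlockLipschitzL ∧ (Q)`** (BY NAME): the crux of record stmt-QuantumFields-19936
from the variance bound for box-local gauge-invariant Lipschitz observables (the Poincaré-inequality letter of K1), the deterministic K2 and the 3/4-quantile
bound (Q) — ✓`expConcentration_of_varianceBound` then T-6's `historyTailL_of_expConcentration_quantile`.  Route glue; nothing here is proved unconditionally.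
[cite: BakryGentilLedoux2014, Prop. 4.4.2; Balaban1985UV3, (7) p.257 and (71) p.273] -/
theorem historyTailL_of_varianceBound_quantile
    (hVar : ∀ (L : ℕ), ∃ cV : ℝ, 0 < cV ∧ ∃ γ₁ : ℝ, 0 < γ₁ ∧ γ₁ ≤ 1 ∧
      ∀ (F : T3Family) (γ : ℝ), F.L = L → 0 < γ → γ ≤ γ₁ → ∀ (K n : ℕ), 1 ≤ n →
        (n : ℝ) ≤ (F.scheme ℰp γ).β K → 2 * n ≤ (F.P K).sitesPerDir 0 →
        ∀ (x₀ : Site (F.P K) 0) (f : GaugeField (F.P K) 0 (Matrix.specialUnitaryGroup (Fin 2) ℂ) → ℝ) (Λ : ℝ), 0 < Λ →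
          Measurable f → GaugeField.GaugeInvariant f →
          (∀ U U' : GaugeField (F.P K) 0 (Matrix.specialUnitaryGroup (Fin 2) ℂ),
            (∀ b : PBond (F.P K) 0, (∀ k, (b.src k - x₀ k).val < n) → (∀ k, (b.tgt k - x₀ k).val < n) → U b = U' b) →
              f U = f U') →
          (∀ U U' : GaugeField (F.P K) 0 (Matrix.specialUnitaryGroup (Fin 2) ℂ),
            |f U - f U'| ≤ Λ * Real.sqrt (∑ b : PBond (F.P K) 0, GaugeGroup.dist1 (U b * (U' b)⁻¹) ^ 2)) →
          ∀ l : ℝ,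
            ∫ U, Real.exp (l * f U) ∂(gibbsK F ℰp γ K) - (∫ U, Real.exp (l / 2 * f U) ∂(gibbsK F ℰp γ K)) ^ 2 ≤
              cV * ((n : ℝ) ^ 2 * Λ ^ 2 / (F.scheme ℰp γ).β K) * l ^ 2 * ∫ U, Real.exp (l * f U) ∂(gibbsK F ℰp γ K))
    (hLip : Summit.QuantumFields.YangMills.Theses.PoincareLipschitz.BlockLipschitzL)
    (hQ : ∀ (L : ℕ) (b₀ p₀ : ℝ), 0 < b₀ → 2 < p₀ → ∃ γ₁ : ℝ, 0 < γ₁ ∧ γ₁ ≤ 1 ∧ ∀ (F : T3Family) (γ : ℝ), F.L = L → 0 < γ → γ ≤ γ₁ →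
            ∀ (K j : ℕ), 1 ≤ j → j + 2 ≤ K → ∀ a : Plaq (F.P K) j,
              3 / 4 ≤ (gibbsK F ℰp γ K).real {U : GaugeField (F.P K) 0 (Matrix.specialUnitaryGroup (Fin 2) ℂ) | GaugeGroup.dist1 (GaugeField.plaqHol (Averaging.iter (fun i' => BlockAveraging.blockAvg (P := F.P K) (j := i') ℰp) j U) a) ≤ θBal F.L γ b₀ p₀ (K - j) / 8}) :
    Summit.QuantumFields.YangMills.Theses.UnitScaleTilt.HistoryTailL :=
  historyTailL_of_expConcentration_quantile (expConcentration_of_varianceBound hVar) hLip hQ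

end Summit.QuantumFields.YangMills.Theorems.PoincareLipschitz.MedianCentring

end
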